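import Mathlib
import Literature.Analysis.Calculus.ExpDuhamel
import Literature.MathematicalPhysics.QuantumFieldTheory.Balaban1983to89.B9Eq349ConjugatedQTowerLetterLinear
import Literature.MathematicalPhysics.QuantumFieldTheory.Balaban1983to89.Beta.AveragingCorrectionJets
import HarnessLib

/-!
# Route «BalabanUVNodes» (cluster K4 «SpineRates»), Track-A DAG node N15 = spine estimate NE2, BACKGROUND LAYER — FIRST MISSING
# ESTIMATE, part 13a: LETTERS FOR `exp` AND `ad` IN A REAL NORMED ALGEBRA — the analytic input of the MATRIX coefficient species
# (`η⁻¹(exp(η ad_{A(b)}) − 1)` of (3.50), `F′_{1,k}(ad_{A(b)})` of (3.51)–(3.52)): Duhamel–Lipschitz and Taylor letters for `NormedSpace.exp`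
# in operator norm (mean-value inequality along one-parameter subgroups), and `‖ad Z‖ ≤ 2‖Z‖`

Cell `pub-ymgap`, seat `pub-ymgap-dag-n15-b` (generation g3; FIRST-MISSING-ESTIMATE, HUMAN RULING D-0062; chair R424 venue; ROSTER-D0062
l.26).  `bears_on: R4∕N15`.  Filed `--supports stmt-QuantumFields-19351`.  Residue (i) of `HOME/HANDOFF-dag-n15-b.md` §g2.3 («the MATRIX
species: the honest 𝔤-valued version of 12c's S1 — `z ↦ η⁻¹(exp(η·ad z) − 1)` Lipschitz ∕ consistency in operator norm via Mathlib
`NormedSpace.exp`»), first of three parts: 13a (this file: the Banach-algebra letters), 13b `BalabanUVNodesN15MatrixSpecies` (the species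
`Phi1`∕`Phi2` on a normed algebra with 12c-shaped letters and fits), 13c `BalabanUVNodesN15MatrixCoefficient` (matrix-coefficient multiplication
operators in the lineage: exact η-defect, block majorant, transfer form).

WHY.  In [Balaban1985BackgroundPropagators] (3.50)–(3.52) p. 400 (verbatim, first-hand; cross-read in 12c's header): (3.50)
*«η^{−2}(2dλ(x) − Σ_{b∈st(x)} exp(iη ad_{A′(b)}) R(U_b)λ(b₊))»*, (3.51) *«where F′_{1,k}(z) = η^{−2}(e^{ηz} − 1 − ηz) = z²∫₀¹dt(1 − t)e^{ηtz},
hence F′_{1,k}(i ad_{A′(b)}) is an analytic function of A(b)»*, (3.52) *«… + Σ_{b∈st(x)} F′_{1,k}(i ad_{A′(b)}) λ(b₊)»*.  The coefficient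
species of `V′₁(A)` are FUNCTIONS OF THE OPERATOR `ad_{A′(b)}` on `𝔤`; the two letters of 12c's `fit_nonlinear` (a `Z`-Lipschitz constant and a
spacing-consistency constant for `Z ↦ Φ(η, Z)`) must therefore be supplied in OPERATOR NORM, uniformly on the box `η‖Z‖ ≤ 1` (p. 397:
*«We will need α₀ so small that O(1)Mα₀ is still a sufficiently small number»*).  They follow from four letters for `exp` in a complete real
normed algebra — Lipschitz and second-order Lipschitz on a ball, second- and third-order Taylor remainders at `0` — proved here by
differentiating ONLY one-parameter subgroups (no commutativity, no power series, no hypothesis on `‖1‖`).  THE PRINT USED (SHAPES only):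
(3.50)–(3.52) p. 400.  Nothing of [B9] asserted.

CONTENTS (all [folklore]; Mathlib `hasDerivAt_exp_smul_const(')`, `norm_image_sub_le_of_norm_deriv_le_segment_01'`; the tree's
`Literature.Analysis.Calculus.norm_exp_sub_one_le` ∕ `hasDerivAt_exp_one_sub_smul` ∕ `norm_mul_mul_le_of_sub_one` ∕ `norm_mul_mul_sub_le_of_sub_one`
(`ExpDuhamel`) and `Beta.AveragingCorrectionJets.adCLM` ∕ `norm_adCLM_le` BY NAME).
* §1 `one_add_norm_exp_smul_sub_one_le(_of_le)` (`1 + ‖e^{ta} − 1‖ ≤ e^{t‖a‖}`), `hasDerivAt_duhamel` (`d∕dt e^{(1−t)B}e^{tA} = e^{(1−t)B}(A − B)e^{tA}`),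
  `norm_exp_sub_exp_le` (DUHAMEL–LIPSCHITZ `‖e^A − e^B‖ ≤ e^ρ‖A − B‖` for `‖A‖, ‖B‖ ≤ ρ`), `norm_exp_sub_exp_sub_sub_le` (second order
  `‖e^A − e^B − (A − B)‖ ≤ (e^ρ − 1)‖A − B‖`), `norm_exp_smul_sub_one_le_of_mem`, `norm_exp_sub_one_sub_self_le` (`‖e^W − 1 − W‖ ≤ ‖W‖(e^{‖W‖} − 1)`,
  from `t ↦ e^{tW} − tW`), `norm_exp_sub_one_sub_sub_sq_le` (`‖e^W − 1 − W − W²∕2‖ ≤ ‖W‖²(e^{‖W‖} − 1)`).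
* §2 THE `ad` LETTER — the tree's `Beta.AveragingCorrectionJets.adCLM ℝ Z = [Z, ·]` (continuous linear operator on a normed algebra `𝔄`,
  `norm_adCLM_le`: `‖ad Z‖ ≤ 2‖Z‖`) BY NAME; here only `adCLM_sub`, `norm_adCLM_sub_le` (`Z ↦ ad Z` is `2`-Lipschitz), `norm_adCLM_le_of_le`.

HONEST FRAMING ∕ LIMITS.  MECHANISM: elementary Banach-algebra calculus; `𝔤` is modelled by ANY real normed algebra `𝔄` and `ad` by the
commutator (bilinearity only); crude constants.  NE2⁺ NOT PRINTED, NOT proved; count-neutral (typed 28∕28; nothing discharged); one finite T⁴ at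
fixed ε — NOT infinite volume, NOT OS on ℝ⁴, NOT a mass gap, NOT Clay.
-/

noncomputable section

namespace Summit.QuantumFields.YangMills.BalabanUVNodes.N15.MatrixSpecies

open NormedSpace Set
open Literature.Analysis.Calculus (norm_exp_sub_one_le norm_mul_mul_le_of_sub_one norm_mul_mul_sub_le_of_sub_one
  hasDerivAt_exp_one_sub_smul)
open Literature.MathematicalPhysics.QuantumFieldTheory.Balaban1983to89.Beta.AveragingCorrectionJets (adCLM adL adCLM_eq_adL
  norm_adCLM_le)

/-! ## §1 Letters for `exp` in a complete real normed algebra -/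

section ExpLetters

variable {𝔸 : Type*} [NormedRing 𝔸] [NormedAlgebra ℝ 𝔸] [CompleteSpace 𝔸]

/-- `1 + ‖e^{ta} − 1‖ ≤ e^{t‖a‖}` for `t ≥ 0` (the tree's `norm_exp_sub_one_le`, no hypothesis on `‖1‖`). [folklore] -/
theorem one_add_norm_exp_smul_sub_one_le (a : 𝔸) {t : ℝ} (ht : 0 ≤ t) :
    1 + ‖exp (t • a) - 1‖ ≤ Real.exp (t * ‖a‖) := by
  have h := norm_exp_sub_one_le (t • a)
  rw [norm_smul, Real.norm_eq_abs, abs_of_nonneg ht] at h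
  linarith

/-- The same with the exponent enlarged: `‖a‖ ≤ ρ`, `0 ≤ t` ⟹ `1 + ‖e^{ta} − 1‖ ≤ e^{tρ}`. [folklore] -/
theorem one_add_norm_exp_smul_sub_one_le_of_le (a : 𝔸) {t ρ : ℝ} (ht : 0 ≤ t) (ha : ‖a‖ ≤ ρ) :
    1 + ‖exp (t • a) - 1‖ ≤ Real.exp (t * ρ) :=
  (one_add_norm_exp_smul_sub_one_le a ht).trans (Real.exp_le_exp.2 (mul_le_mul_of_nonneg_left ha ht))

/-- The derivative of Duhamel's interpolation `t ↦ e^{(1−t)B}e^{tA}` is `e^{(1−t)B}(A − B)e^{tA}` (only one-parameter subgroups are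
differentiated; Mathlib `hasDerivAt_exp_smul_const'` and the tree's `hasDerivAt_exp_one_sub_smul`). [folklore] -/
theorem hasDerivAt_duhamel (A B : 𝔸) (t : ℝ) :
    HasDerivAt (fun u : ℝ => exp ((1 - u) • B) * exp (u • A)) (exp ((1 - t) • B) * (A - B) * exp (t • A)) t := by
  have h := (hasDerivAt_exp_one_sub_smul B t).fun_mul (hasDerivAt_exp_smul_const' (𝕂 := ℝ) A t)
  have heq : -(exp ((1 - t) • B) * B) * exp (t • A) + exp ((1 - t) • B) * (A * exp (t • A)) =
      exp ((1 - t) • B) * (A - B) * exp (t • A) := by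
    noncomm_ring
  rw [heq] at h
  exact h

/-- DUHAMEL–LIPSCHITZ: `‖A‖, ‖B‖ ≤ ρ` ⟹ `‖e^A − e^B‖ ≤ e^ρ·‖A − B‖` — the mean-value inequality for `t ↦ e^{(1−t)B}e^{tA}` on `[0,1]` with
`‖e^{(1−t)B}(A − B)e^{tA}‖ ≤ e^{(1−t)ρ}‖A − B‖e^{tρ}`. [folklore] -/
theorem norm_exp_sub_exp_le {A B : 𝔸} {ρ : ℝ} (hA : ‖A‖ ≤ ρ) (hB : ‖B‖ ≤ ρ) :
    ‖exp A - exp B‖ ≤ Real.exp ρ * ‖A - B‖ := by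
  have hbound : ∀ t ∈ Ico (0 : ℝ) 1,
      ‖exp ((1 - t) • B) * (A - B) * exp (t • A)‖ ≤ Real.exp ρ * ‖A - B‖ := by
    intro t ht
    have h1 : 1 + ‖exp ((1 - t) • B) - 1‖ ≤ Real.exp ((1 - t) * ρ) :=
      one_add_norm_exp_smul_sub_one_le_of_le B (by linarith [ht.2]) hB
    have h2 : 1 + ‖exp (t • A) - 1‖ ≤ Real.exp (t * ρ) := one_add_norm_exp_smul_sub_one_le_of_le A ht.1 hA
    have hρ : Real.exp ((1 - t) * ρ) * Real.exp (t * ρ) = Real.exp ρ := by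
      rw [← Real.exp_add]; ring_nf
    calc ‖exp ((1 - t) • B) * (A - B) * exp (t • A)‖
        ≤ (1 + ‖exp ((1 - t) • B) - 1‖) * ‖A - B‖ * (1 + ‖exp (t • A) - 1‖) := norm_mul_mul_le_of_sub_one _ _ _
      _ ≤ Real.exp ((1 - t) * ρ) * ‖A - B‖ * Real.exp (t * ρ) := by gcongr
      _ = Real.exp ρ * ‖A - B‖ := by rw [mul_right_comm, hρ]
  have hmvt := norm_image_sub_le_of_norm_deriv_le_segment_01'
    (fun t _ => (hasDerivAt_duhamel A B t).hasDerivWithinAt) hbound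
  simpa using hmvt

/-- SECOND ORDER: `‖A‖, ‖B‖ ≤ ρ` ⟹ `‖e^A − e^B − (A − B)‖ ≤ (e^ρ − 1)·‖A − B‖` — the mean-value inequality for
`t ↦ e^{(1−t)B}e^{tA} − t(A − B)`, with `‖e^{(1−t)B}(A − B)e^{tA} − (A − B)‖ ≤ (e^{(1−t)ρ}e^{tρ} − 1)‖A − B‖` (the tree's
`norm_mul_mul_sub_le_of_sub_one`). [folklore] -/
theorem norm_exp_sub_exp_sub_sub_le {A B : 𝔸} {ρ : ℝ} (hA : ‖A‖ ≤ ρ) (hB : ‖B‖ ≤ ρ) :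
    ‖exp A - exp B - (A - B)‖ ≤ (Real.exp ρ - 1) * ‖A - B‖ := by
  have hF : ∀ t : ℝ, HasDerivAt (fun u : ℝ => exp ((1 - u) • B) * exp (u • A) - u • (A - B))
      (exp ((1 - t) • B) * (A - B) * exp (t • A) - (A - B)) t := by
    intro t
    have h2 : HasDerivAt (fun u : ℝ => u • (A - B)) (A - B) t := by
      simpa using (hasDerivAt_id t).smul_const (A - B)
    exact (hasDerivAt_duhamel A B t).fun_sub h2
  have hbound : ∀ t ∈ Ico (0 : ℝ) 1,
      ‖exp ((1 - t) • B) * (A - B) * exp (t • A) - (A - B)‖ ≤ (Real.exp ρ - 1) * ‖A - B‖ := by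
    intro t ht
    have h1 : 1 + ‖exp ((1 - t) • B) - 1‖ ≤ Real.exp ((1 - t) * ρ) :=
      one_add_norm_exp_smul_sub_one_le_of_le B (by linarith [ht.2]) hB
    have h2 : 1 + ‖exp (t • A) - 1‖ ≤ Real.exp (t * ρ) := one_add_norm_exp_smul_sub_one_le_of_le A ht.1 hA
    have hρ : Real.exp ((1 - t) * ρ) * Real.exp (t * ρ) = Real.exp ρ := by
      rw [← Real.exp_add]; ring_nf
    have h0a : 0 ≤ 1 + ‖exp ((1 - t) • B) - 1‖ := by positivity
    have hprod : (1 + ‖exp ((1 - t) • B) - 1‖) * (1 + ‖exp (t • A) - 1‖) ≤ Real.exp ρ := by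
      rw [← hρ]
      exact mul_le_mul h1 h2 (by positivity) ((Real.exp_pos _).le)
    calc ‖exp ((1 - t) • B) * (A - B) * exp (t • A) - (A - B)‖
        ≤ ((1 + ‖exp ((1 - t) • B) - 1‖) * (1 + ‖exp (t • A) - 1‖) - 1) * ‖A - B‖ :=
          norm_mul_mul_sub_le_of_sub_one _ _ _
      _ ≤ (Real.exp ρ - 1) * ‖A - B‖ := by gcongr
  have hmvt := norm_image_sub_le_of_norm_deriv_le_segment_01' (fun t _ => (hF t).hasDerivWithinAt) hbound
  have heq : exp A - exp B - (A - B) = (exp ((1 - (1 : ℝ)) • B) * exp ((1 : ℝ) • A) - (1 : ℝ) • (A - B)) -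
      (exp ((1 - (0 : ℝ)) • B) * exp ((0 : ℝ) • A) - (0 : ℝ) • (A - B)) := by
    simp only [sub_self, zero_smul, exp_zero, one_smul, one_mul, sub_zero, mul_one]
    abel
  rw [heq]
  exact hmvt

/-- `‖e^{tW} − 1‖ ≤ e^{‖W‖} − 1` for `0 ≤ t ≤ 1`. [folklore] -/
theorem norm_exp_smul_sub_one_le_of_mem (W : 𝔸) {t : ℝ} (ht0 : 0 ≤ t) (ht1 : t ≤ 1) :
    ‖exp (t • W) - 1‖ ≤ Real.exp ‖W‖ - 1 := by
  have h := norm_exp_sub_one_le (t • W)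
  have hn : ‖t • W‖ ≤ ‖W‖ := by
    rw [norm_smul, Real.norm_eq_abs, abs_of_nonneg ht0]
    exact mul_le_of_le_one_left (norm_nonneg _) ht1
  linarith [Real.exp_le_exp.2 hn]

/-- SECOND ORDER AT ZERO: `‖e^W − 1 − W‖ ≤ ‖W‖·(e^{‖W‖} − 1)` — the mean-value inequality for `t ↦ e^{tW} − tW`, whose derivative is
`(e^{tW} − 1)W`. [folklore] -/
theorem norm_exp_sub_one_sub_self_le (W : 𝔸) : ‖exp W - 1 - W‖ ≤ ‖W‖ * (Real.exp ‖W‖ - 1) := by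
  have hG : ∀ t : ℝ, HasDerivAt (fun u : ℝ => exp (u • W) - u • W) ((exp (t • W) - 1) * W) t := by
    intro t
    have h1 := hasDerivAt_exp_smul_const (𝕂 := ℝ) W t
    have h2 : HasDerivAt (fun u : ℝ => u • W) W t := by simpa using (hasDerivAt_id t).smul_const W
    have h := h1.fun_sub h2
    have heq : exp (t • W) * W - W = (exp (t • W) - 1) * W := by noncomm_ring
    rw [heq] at h
    exact h
  have hbound : ∀ t ∈ Ico (0 : ℝ) 1, ‖(exp (t • W) - 1) * W‖ ≤ ‖W‖ * (Real.exp ‖W‖ - 1) := by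
    intro t ht
    have h1 := norm_exp_smul_sub_one_le_of_mem W ht.1 ht.2.le
    calc ‖(exp (t • W) - 1) * W‖ ≤ ‖exp (t • W) - 1‖ * ‖W‖ := norm_mul_le _ _
      _ ≤ (Real.exp ‖W‖ - 1) * ‖W‖ := mul_le_mul_of_nonneg_right h1 (norm_nonneg W)
      _ = ‖W‖ * (Real.exp ‖W‖ - 1) := mul_comm _ _
  have hmvt := norm_image_sub_le_of_norm_deriv_le_segment_01' (fun t _ => (hG t).hasDerivWithinAt) hbound
  have heq : exp W - 1 - W = (exp ((1 : ℝ) • W) - (1 : ℝ) • W) - (exp ((0 : ℝ) • W) - (0 : ℝ) • W) := by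
    simp only [one_smul, zero_smul, exp_zero, sub_zero]
    abel
  rw [heq]
  exact hmvt

/-- THIRD ORDER AT ZERO: `‖e^W − 1 − W − W²∕2‖ ≤ ‖W‖²·(e^{‖W‖} − 1)` — the mean-value inequality for
`t ↦ e^{tW} − tW − (t²∕2)W²`, whose derivative is `(e^{tW} − 1 − tW)W`, bounded by §1's second-order letter at `tW`. [folklore] -/
theorem norm_exp_sub_one_sub_sub_sq_le (W : 𝔸) :
    ‖exp W - 1 - W - (2 : ℝ)⁻¹ • W ^ 2‖ ≤ ‖W‖ ^ 2 * (Real.exp ‖W‖ - 1) := by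
  have hF : ∀ t : ℝ, HasDerivAt (fun u : ℝ => exp (u • W) - u • W - (u * u * 2⁻¹) • W ^ 2)
      ((exp (t • W) - 1 - t • W) * W) t := by
    intro t
    have h1 := hasDerivAt_exp_smul_const (𝕂 := ℝ) W t
    have h2 : HasDerivAt (fun u : ℝ => u • W) W t := by simpa using (hasDerivAt_id t).smul_const W
    have h3 : HasDerivAt (fun u : ℝ => (u * u * 2⁻¹) • W ^ 2) (((1 * t + t * 1) * 2⁻¹) • W ^ 2) t :=
      (((hasDerivAt_id t).mul (hasDerivAt_id t)).mul_const (2⁻¹ : ℝ)).smul_const (W ^ 2)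
    have h := (h1.fun_sub h2).fun_sub h3
    have heq : exp (t • W) * W - W - ((1 * t + t * 1) * 2⁻¹) • W ^ 2 = (exp (t • W) - 1 - t • W) * W := by
      have ht : (1 * t + t * 1) * (2⁻¹ : ℝ) = t := by ring
      rw [ht, sub_mul, sub_mul, one_mul, smul_mul_assoc, pow_two]
    rw [heq] at h
    exact h
  have hbound : ∀ t ∈ Ico (0 : ℝ) 1, ‖(exp (t • W) - 1 - t • W) * W‖ ≤ ‖W‖ ^ 2 * (Real.exp ‖W‖ - 1) := by
    intro t ht
    have hn : ‖t • W‖ ≤ ‖W‖ := by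
      rw [norm_smul, Real.norm_eq_abs, abs_of_nonneg ht.1]
      exact mul_le_of_le_one_left (norm_nonneg _) ht.2.le
    have he : 0 ≤ Real.exp ‖t • W‖ - 1 := by linarith [Real.add_one_le_exp ‖t • W‖, norm_nonneg (t • W)]
    have h1 : ‖exp (t • W) - 1 - t • W‖ ≤ ‖W‖ * (Real.exp ‖W‖ - 1) :=
      (norm_exp_sub_one_sub_self_le (t • W)).trans
        (mul_le_mul hn (by linarith [Real.exp_le_exp.2 hn]) he (norm_nonneg _))
    calc ‖(exp (t • W) - 1 - t • W) * W‖ ≤ ‖exp (t • W) - 1 - t • W‖ * ‖W‖ := norm_mul_le _ _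
      _ ≤ ‖W‖ * (Real.exp ‖W‖ - 1) * ‖W‖ := mul_le_mul_of_nonneg_right h1 (norm_nonneg W)
      _ = ‖W‖ ^ 2 * (Real.exp ‖W‖ - 1) := by ring
  have hmvt := norm_image_sub_le_of_norm_deriv_le_segment_01' (fun t _ => (hF t).hasDerivWithinAt) hbound
  have heq : exp W - 1 - W - (2 : ℝ)⁻¹ • W ^ 2 =
      (exp ((1 : ℝ) • W) - (1 : ℝ) • W - ((1 : ℝ) * 1 * 2⁻¹) • W ^ 2) -
        (exp ((0 : ℝ) • W) - (0 : ℝ) • W - ((0 : ℝ) * 0 * 2⁻¹) • W ^ 2) := by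
    simp only [one_smul, zero_smul, exp_zero, sub_zero, one_mul, zero_mul]
    abel
  rw [heq]
  exact hmvt

end ExpLetters

/-! ## §2 The `ad` letter (the tree's `Beta.AveragingCorrectionJets.adCLM` BY NAME) -/

section Ad

variable {𝔄 : Type*} [NormedRing 𝔄] [NormedAlgebra ℝ 𝔄]

/-- `ad` is additive in its letter: `ad Z₁ − ad Z₂ = ad (Z₁ − Z₂)` for the tree's continuous-linear `adCLM ℝ Z = [Z, ·]`
(`Beta.AveragingCorrectionJets.adCLM`, `= adL ℝ Z` with `adL` continuous linear in the letter). [folklore] -/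
theorem adCLM_sub (Z₁ Z₂ : 𝔄) : adCLM ℝ Z₁ - adCLM ℝ Z₂ = adCLM ℝ (Z₁ - Z₂) := by
  rw [adCLM_eq_adL, adCLM_eq_adL, adCLM_eq_adL, map_sub]

/-- THE `ad` LETTER, Lipschitz form: `Z ↦ ad Z` is `2`-Lipschitz in operator norm (the tree's `norm_adCLM_le`: `‖ad Z‖ ≤ 2‖Z‖`). [folklore] -/
theorem norm_adCLM_sub_le (Z₁ Z₂ : 𝔄) : ‖adCLM ℝ Z₁ - adCLM ℝ Z₂‖ ≤ 2 * ‖Z₁ - Z₂‖ := by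
  rw [adCLM_sub]
  exact norm_adCLM_le ℝ _

/-- `‖Z‖ ≤ r` ⟹ `‖ad Z‖ ≤ 2r` (the box of the species letters for the print's argument `ad_{A(b)}`). [folklore] -/
theorem norm_adCLM_le_of_le {Z : 𝔄} {r : ℝ} (hZ : ‖Z‖ ≤ r) : ‖adCLM ℝ Z‖ ≤ 2 * r :=
  (norm_adCLM_le ℝ Z).trans (by linarith)

end Ad

end Summit.QuantumFields.YangMills.BalabanUVNodes.N15.MatrixSpecies
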